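import Summits.CriticalPhenomena.CardyFormulaZ2.Theorems.CardyIKTransportIKLinearTransportLine

/-!
# Line `pinned-diagram-exchange` of crux `CardyIKTransport.IKLinearTransport` (stmt-CriticalPhenomena-5076):
# vocabulary of the reshape of `stub_PinnedExchange` (skeleton v5 of the lead, 2026-08-16)

Support file (`--supports stmt-CriticalPhenomena-5076`). The registered stub
`stub_PinnedExchange : (∀ L, 3 ≤ L → DiagramExchangeAt L) → ∃ C c, 0 < c ∧ ∀ S i, (i ∈ S ↔ i + 1 ∉ S) →
∃ T, IsExchangeKernel C c S i T` (Fact 5.15 of arXiv:2502.08394 for the Izergin–Korepin family: the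
infinite-volume diagram-pinned exchange maps) is split by the lead into three registered stubs over the
vocabulary below (gap analysis of the wave-1 worker, `work/stubs/StubPinnedExchangeGap.lean`, all audited rc 0):

* `stub_StripDiagramExchange : (∀ L, 3 ≤ L → DiagramExchangeAt L) → ∀ S i, (i ∈ S ↔ i + 1 ∉ S) →
  StripDiagramExchange S i` — "`DiagramExchangeAt ∞`": the joint law of (observables off the exchanged
  columns, STRIP DIAGRAM) is the same for `S` and `S ∆ {i, i+1}` (cylinder `ℤ/L` → bi-infinite strip by the
  corridor bound; false on finite open strips);
* `stub_PinnedSampler : ∃ C c, 0 < c ∧ ∀ S i, (i ∈ S ↔ i + 1 ∉ S) → ∃ G, PinnedSampler C c S i G` — THE BET of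
  the line: a measurable, vertically covariant, exponentially quasi-local resampling of the middle data
  preserving the strip diagram and transporting the law given `StripDiagramExchange`;
* `stub_ExchangeAssembly : ∀ C c S i G, (i ∈ S ↔ i + 1 ∉ S) → StripDiagramExchange S i → PinnedSampler C c S i G →
  IsExchangeKernel C c S i G` — diagram preservation + law transport + locality ⇒
  `IsExchangeKernel` (cluster membership of off-column cells is preserved because every monochromatic path
  splits into off-column pieces and strip-internal pieces between boundary cells).

This file: the definitions `eraseMid`, `stripDiagram`, `StripDiagramExchange`, `PinnedSampler` (all
parametrised predicates — a closed `Prop` would be relocated by the gate as a cited fact), and the sorry-free composition `pinnedExchange_of_parts` (registered sub-goal) showing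
that the three new stubs imply the registered `stub_PinnedExchange` signature verbatim. Objects the line posits;
nothing here is a literature fact.

References: I. Manolescu, arXiv:2502.08394, Fact 5.15 p. 61, Cor. 5.16; the line card
`Cruxes/IKLinearTransport/Lines/pinned-diagram-exchange.md`; landed helpers `…StubPinnedExchange.lean` (p84275).
-/

noncomputable section

namespace Summit.CriticalPhenomena.CardyFormulaZ2.Theorems.IKLinearTransport.PinnedDiagramExchange

open scoped Classical MeasureTheory ENNReal symmDiff
open Set MeasureTheory
open Literature.Probability.Percolation Literature.Probability.LatticeModels

/-- Observables with cell column `i+1` and face columns `i, i+1` erased (the data an exchange map at the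
face columns `i, i+1` may rewrite). [folklore] -/
def eraseMid (i : ℤ) (x : Obs) : Obs :=
  ({v ∈ x.1 | v 0 ≠ i + 1}, {f ∈ x.2 | f 0 ≠ i ∧ f 0 ≠ i + 1})

/-- The STRIP DIAGRAM at `i`: pairs of boundary cells (cell columns `i`, `i+2`) joined by a monochromatic
path of `cellGraph x.2` staying inside cell columns `i, i+1, i+2` — the infinite-strip analogue of the
vocabulary's `blockDiagram`. [folklore] -/
def stripDiagram (i : ℤ) (x : Obs) : Set (Site 2 × Site 2) :=
  {pq | (pq.1 0 = i ∨ pq.1 0 = i + 2) ∧ (pq.2 0 = i ∨ pq.2 0 = i + 2) ∧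
    ∃ h : (pq.2 ∈ x.1 ↔ pq.1 ∈ x.1) ∧ i ≤ pq.2 0 ∧ pq.2 0 ≤ i + 2,
      ∃ h1 : i ≤ pq.1 0 ∧ pq.1 0 ≤ i + 2,
        ((cellGraph x.2).induce {v | (v ∈ x.1 ↔ pq.1 ∈ x.1) ∧ i ≤ v 0 ∧ v 0 ≤ i + 2}).Reachable
          ⟨pq.1, ⟨Iff.rfl, h1⟩⟩ ⟨pq.2, h⟩}

/-- STUB STATEMENT (v5) · `StripDiagramExchange S i` ("`DiagramExchangeAt ∞`"): the joint law of
(off-column observables, strip diagram) under `νmix` is the same for the column patterns `S` and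
`S ∆ {i, i+1}`. A statement the line POSITS. [folklore] -/
def StripDiagramExchange (S : Set ℤ) (i : ℤ) : Prop :=
  (νmix S).map (fun x => (eraseMid i x, stripDiagram i x)) =
    (νmix (S ∆ {i, i + 1})).map (fun x => (eraseMid i x, stripDiagram i x))

/-- STUB STATEMENT (v5) · `PinnedSampler C c S i G`, THE BET of the line, as a predicate on a candidate
resampling map `G` (reading the observables `x` and fresh bits `u`): `G` is measurable, rewrites only the
middle data (`eraseMid` preserved surely), preserves the strip diagram surely, is vertically covariant,
pushes `νmix S ⊗ β` forward to `νmix (S ∆ {i,i+1})` GIVEN `StripDiagramExchange S i` (the conditional-law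
clause stated through this consequence, avoiding disintegration vocabulary), and is quasi-local with
exponential tails exactly as clause (v) of `IsExchangeKernel`. A statement the line POSITS. [folklore] -/
def PinnedSampler (C c : ℝ) (S : Set ℤ) (i : ℤ) (G : Obs → Rnd → Obs) : Prop :=
  Measurable (Function.uncurry G) ∧
  (∀ x u, eraseMid i (G x u) = eraseMid i x) ∧
  (∀ x u, stripDiagram i (G x u) = stripDiagram i x) ∧
  (∀ (m : ℤ) x u, G (vshift m x) (ushift m u) = vshift m (G x u)) ∧
  (StripDiagramExchange S i →
    ((νmix S).prod β).map (Function.uncurry G) = νmix (S ∆ {i, i + 1})) ∧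
  (∀ (v : Site 2) (r : ℕ), ∃ Gloc : Obs → Rnd → Obs,
    (∀ (x x' : Obs) (u u' : Rnd),
      (∀ w ∈ ballInf v (2 * r), (w ∈ x.1 ↔ w ∈ x'.1) ∧ (w ∈ x.2 ↔ w ∈ x'.2) ∧
        ∀ k : ℕ, ((w, k) ∈ u ↔ (w, k) ∈ u')) →
      ∀ w ∈ ballInf v r, (w ∈ (Gloc x u).1 ↔ w ∈ (Gloc x' u').1) ∧
        (w ∈ (Gloc x u).2 ↔ w ∈ (Gloc x' u').2)) ∧
    ((νmix S).prod β) {xu | ∃ w ∈ ballInf v r,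
        ¬ ((w ∈ (G xu.1 xu.2).1 ↔ w ∈ (Gloc xu.1 xu.2).1) ∧
           (w ∈ (G xu.1 xu.2).2 ↔ w ∈ (Gloc xu.1 xu.2).2))} ≤
      ENNReal.ofReal (C * Real.exp (-c * r)))

/-- COMPOSITION of the v5 reshape (sorry-free; registered sub-goal `pinnedExchange_of_parts`): strip diagram
exchange from the finite pinned identity, a pinned sampler with uniform constants, and the assembly give the
registered `stub_PinnedExchange` signature verbatim. [folklore] -/
theorem pinnedExchange_of_parts :
    ((∀ (L : ℕ) [NeZero L], 3 ≤ L → DiagramExchangeAt L) →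
      ∀ (S : Set ℤ) (i : ℤ), (i ∈ S ↔ i + 1 ∉ S) → StripDiagramExchange S i) →
    (∃ C c : ℝ, 0 < c ∧ ∀ (S : Set ℤ) (i : ℤ), (i ∈ S ↔ i + 1 ∉ S) →
      ∃ G : Obs → Rnd → Obs, PinnedSampler C c S i G) →
    (∀ (C c : ℝ) (S : Set ℤ) (i : ℤ) (G : Obs → Rnd → Obs), (i ∈ S ↔ i + 1 ∉ S) →
      StripDiagramExchange S i → PinnedSampler C c S i G → IsExchangeKernel C c S i G) →
    ((∀ (L : ℕ) [NeZero L], 3 ≤ L → DiagramExchangeAt L) →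
      ∃ C c : ℝ, 0 < c ∧ ∀ (S : Set ℤ) (i : ℤ), (i ∈ S ↔ i + 1 ∉ S) →
        ∃ T : Obs → Rnd → Obs, IsExchangeKernel C c S i T) := by
  intro hStrip hSampler hAsm hDX
  obtain ⟨C, c, hc, hG⟩ := hSampler
  refine ⟨C, c, hc, fun S i hSi => ?_⟩
  obtain ⟨G, hPG⟩ := hG S i hSi
  exact ⟨G, hAsm C c S i G hSi (hStrip hDX S i hSi) hPG⟩

end Summit.CriticalPhenomena.CardyFormulaZ2.Theorems.IKLinearTransport.PinnedDiagramExchange
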